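import Mathlib.Analysis.SpecialFunctions.Trigonometric.Bounds
import Mathlib.Algebra.Order.Floor.Defs
import Mathlib.Data.Int.Interval
import Mathlib.Algebra.BigOperators.Ring.Finset
import HarnessLib

/-!
# Cosine windows for the block reduction of animal certificates: an explicit partition of unity on `ℤ` with gradient bound

`SemilocalDeletionAnimalBlocks.latticeCert_of_blocks` (p389602) reduces the lattice (animal) certificate of `SemilocalDeletionAnimalFloor`
(p389024) to BLOCK certificates, given real windows `χ_j` with `Σ_j χ_j(k)² = 1` on the support and `Σ_j (χ_j(k + d_n) − χ_j(k))² ≤ ε_n`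
along the edges.  This file supplies the concrete family used by the cell's certified lattice engine («lineage Lc», cc-s2-1 gen17,
ANIMAL-SUPREMUM.md): slice along one lattice coordinate `k_s` with windows `χ_j(k) = ψ(k_s/ℓ − j)`, profile

  `ψ(t) = cos((π/2)·max(−1, min(1, t)))`  (`= cos(πt/2)` on `[−1, 1]`, `0` outside; written inline, no definition).

* `cosWindow_eq_zero_of_one_le` / `…_of_le_neg_one` (support `(−1, 1)`), `abs_cosWindow_sub_le` (`π/2`-Lipschitz: clamping is
  `1`-Lipschitz, `cos` is `1`-Lipschitz), `cosWindow_sq_add_sq` (`ψ(u)² + ψ(u−1)² = 1` on `[0,1]`: `cos² + sin²`);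
* `sum_cosWindow_sq_eq_one`: `Σ_{j∈s} ψ(t − j)² = 1` for every real `t` and every finite `s ∋ ⌊t⌋, ⌊t⌋+1` — hypothesis `hχ1`;
* `sum_cosWindow_sub_sq_le`: `Σ_{j∈s} (ψ(t + h − j) − ψ(t − j))² ≤ 3(πh/2)²` for `0 ≤ h ≤ 1` (only `j ∈ {⌊t⌋, ⌊t⌋+1, ⌊t⌋+2}` move) —
  with `t = k_s/ℓ`, `h = v_s(n)/ℓ` this is hypothesis `hχ2` with `ε_n = 3(π v_s(n)/(2ℓ))²`, so block certificates of `k_s`-length `2ℓ`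
  cost `3(π/2ℓ)² Σ_n |w_n| v_s(n)²` in the constant.

Pure real analysis (Mathlib only); nothing here bears on RH.
-/

set_option linter.dupNamespace false

noncomputable section

open Real Finset

namespace Summit.RiemannHypothesis.RiemannHypothesis.Theorems.SemilocalDeletionAnimalWindows

/-- The cosine window profile `ψ(t) = cos((π/2)·clamp t)`, `clamp t = max (−1) (min 1 t)`, vanishes for `t ≥ 1`. -/
theorem cosWindow_eq_zero_of_one_le {t : ℝ} (ht : 1 ≤ t) : Real.cos (π / 2 * max (-1) (min 1 t)) = 0 := by
  rw [min_eq_left ht, max_eq_right (by norm_num), mul_one, Real.cos_pi_div_two]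

/-- … and for `t ≤ −1`. -/
theorem cosWindow_eq_zero_of_le_neg_one {t : ℝ} (ht : t ≤ -1) : Real.cos (π / 2 * max (-1) (min 1 t)) = 0 := by
  rw [min_eq_right (by linarith), max_eq_left ht, mul_neg_one, Real.cos_neg, Real.cos_pi_div_two]

/-- The window profile is `π/2`-Lipschitz. -/
theorem abs_cosWindow_sub_le (a c : ℝ) :
    |Real.cos (π / 2 * max (-1) (min 1 a)) - Real.cos (π / 2 * max (-1) (min 1 c))| ≤ π / 2 * |a - c| := by
  refine (Real.abs_cos_sub_cos_le _ _).trans ?_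
  rw [← mul_sub, abs_mul, abs_of_pos (by positivity : (0 : ℝ) < π / 2)]
  refine mul_le_mul_of_nonneg_left ?_ (by positivity)
  calc |max (-1) (min 1 a) - max (-1) (min 1 c)| ≤ max |(-1 : ℝ) - -1| |min 1 a - min 1 c| := abs_max_sub_max_le_max _ _ _ _
    _ ≤ max |(-1 : ℝ) - -1| (max |(1 : ℝ) - 1| |a - c|) := max_le_max le_rfl (abs_min_sub_min_le_max _ _ _ _)
    _ = |a - c| := by simp [abs_nonneg]

/-- Two adjacent windows square-sum to one: `ψ(u)² + ψ(u − 1)² = 1` for `u ∈ [0, 1]`. -/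
theorem cosWindow_sq_add_sq {u : ℝ} (h0 : 0 ≤ u) (h1 : u ≤ 1) :
    Real.cos (π / 2 * max (-1) (min 1 u)) ^ 2 + Real.cos (π / 2 * max (-1) (min 1 (u - 1))) ^ 2 = 1 := by
  rw [min_eq_right h1, max_eq_right (by linarith), min_eq_right (by linarith), max_eq_right (by linarith),
    show π / 2 * (u - 1) = π / 2 * u - π / 2 by ring, Real.cos_sub_pi_div_two, Real.cos_sq_add_sin_sq]

/-- **Partition of unity.** For every real `t` and every finite set `s` of integers containing `⌊t⌋` and `⌊t⌋ + 1`: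
`Σ_{j ∈ s} ψ(t − j)² = 1`. -/
theorem sum_cosWindow_sq_eq_one (t : ℝ) {s : Finset ℤ} (h0 : ⌊t⌋ ∈ s) (h1 : ⌊t⌋ + 1 ∈ s) :
    ∑ j ∈ s, Real.cos (π / 2 * max (-1) (min 1 (t - j))) ^ 2 = 1 := by
  have hvan : ∀ j ∈ s, j ≠ ⌊t⌋ → j ≠ ⌊t⌋ + 1 → Real.cos (π / 2 * max (-1) (min 1 (t - j))) ^ 2 = 0 := by
    intro j _ hj0 hj1
    rcases lt_or_gt_of_ne hj0 with hlt | hgt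
    · have : (j : ℝ) ≤ ⌊t⌋ - 1 := by exact_mod_cast Int.le_sub_one_of_lt hlt
      rw [cosWindow_eq_zero_of_one_le (by linarith [Int.floor_le t]), zero_pow two_ne_zero]
    · have hge : ⌊t⌋ + 2 ≤ j := by omega
      have : (⌊t⌋ : ℝ) + 2 ≤ j := by exact_mod_cast hge
      rw [cosWindow_eq_zero_of_le_neg_one (by linarith [Int.lt_floor_add_one t]), zero_pow two_ne_zero]
  rw [← Finset.sum_subset (Finset.insert_subset h0 (Finset.singleton_subset_iff.2 h1))
    (fun j hj hjn ↦ hvan j hj (fun h ↦ hjn (by simp [h])) (fun h ↦ hjn (by simp [h]))),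
    Finset.sum_insert (by simp), Finset.sum_singleton]
  have hu0 : 0 ≤ t - ⌊t⌋ := sub_nonneg.2 (Int.floor_le t)
  have hu1 : t - ⌊t⌋ ≤ 1 := by linarith [Int.lt_floor_add_one t]
  have e : t - ((⌊t⌋ + 1 : ℤ) : ℝ) = (t - ⌊t⌋) - 1 := by push_cast; ring
  rw [e]
  exact cosWindow_sq_add_sq hu0 hu1

/-- **Gradient bound.** For `0 ≤ h ≤ 1` and any finite set `s` of integers:
`Σ_{j ∈ s} (ψ(t + h − j) − ψ(t − j))² ≤ 3·(πh/2)²` (at most three windows move, each by at most `πh/2`). -/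
theorem sum_cosWindow_sub_sq_le (t : ℝ) {h : ℝ} (hh0 : 0 ≤ h) (hh1 : h ≤ 1) (s : Finset ℤ) :
    ∑ j ∈ s, (Real.cos (π / 2 * max (-1) (min 1 (t + h - j))) - Real.cos (π / 2 * max (-1) (min 1 (t - j)))) ^ 2 ≤
      3 * (π / 2 * h) ^ 2 := by
  set f : ℤ → ℝ := fun j ↦ (Real.cos (π / 2 * max (-1) (min 1 (t + h - j))) - Real.cos (π / 2 * max (-1) (min 1 (t - j)))) ^ 2
  have hf0 : ∀ j, 0 ≤ f j := fun j ↦ sq_nonneg _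
  have hfle : ∀ j, f j ≤ (π / 2 * h) ^ 2 := by
    intro j
    have := abs_cosWindow_sub_le (t + h - j) (t - j)
    rw [show t + h - j - (t - j) = h by ring, abs_of_nonneg hh0] at this
    have hnn : 0 ≤ π / 2 * h := by positivity
    calc f j = |Real.cos (π / 2 * max (-1) (min 1 (t + h - j))) - Real.cos (π / 2 * max (-1) (min 1 (t - j)))| ^ 2 := by
          simp only [f, sq_abs]
      _ ≤ (π / 2 * h) ^ 2 := pow_le_pow_left₀ (abs_nonneg _) this 2
  -- outside `[⌊t⌋, ⌊t⌋ + 2]` both window values vanish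
  have hvan : ∀ j ∈ s, j ∉ Finset.Icc ⌊t⌋ (⌊t⌋ + 2) → f j = 0 := by
    intro j _ hj
    rw [Finset.mem_Icc, not_and_or, not_le, not_le] at hj
    simp only [f]
    rcases hj with hlt | hgt
    · have : (j : ℝ) ≤ ⌊t⌋ - 1 := by exact_mod_cast Int.le_sub_one_of_lt hlt
      rw [cosWindow_eq_zero_of_one_le (by linarith [Int.floor_le t]), cosWindow_eq_zero_of_one_le (by linarith [Int.floor_le t])]
      simp
    · have : (⌊t⌋ : ℝ) + 3 ≤ j := by exact_mod_cast (show ⌊t⌋ + 3 ≤ j by omega)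
      rw [cosWindow_eq_zero_of_le_neg_one (by linarith [Int.lt_floor_add_one t]),
        cosWindow_eq_zero_of_le_neg_one (by linarith [Int.lt_floor_add_one t])]
      simp
  calc ∑ j ∈ s, f j = ∑ j ∈ s ∩ Finset.Icc ⌊t⌋ (⌊t⌋ + 2), f j := by
        rw [← Finset.sum_subset Finset.inter_subset_left fun j hj hjn ↦ hvan j hj fun h ↦ hjn (Finset.mem_inter.2 ⟨hj, h⟩)]
    _ ≤ ∑ j ∈ Finset.Icc ⌊t⌋ (⌊t⌋ + 2), f j := Finset.sum_le_sum_of_subset_of_nonneg Finset.inter_subset_right fun j _ _ ↦ hf0 j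
    _ ≤ ∑ j ∈ Finset.Icc ⌊t⌋ (⌊t⌋ + 2), (π / 2 * h) ^ 2 := Finset.sum_le_sum fun j _ ↦ hfle j
    _ = 3 * (π / 2 * h) ^ 2 := by
        rw [Finset.sum_const, Int.card_Icc, nsmul_eq_mul, show ⌊t⌋ + 2 + 1 - ⌊t⌋ = (3 : ℤ) by ring,
          show Int.toNat 3 = 3 from rfl]
        push_cast
        ring

end Summit.RiemannHypothesis.RiemannHypothesis.Theorems.SemilocalDeletionAnimalWindows

end
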